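import Mathlib
import HarnessLib
import Summits.ValiantsHypothesis.ValiantsHypothesis.Theses.MonotoneRestoration
import Literature.Computability.AlgebraicComplexity.ArithCircuit
import Literature.Computability.AlgebraicComplexity.ArithCircuitProofs
import Literature.Computability.AlgebraicComplexity.MonotoneStructure
import Literature.Computability.AlgebraicComplexity.PermanentIrreducible
import Literature.ModelTheory.FiniteModelTheory.CkEquiv
import Summits.ValiantsHypothesis.ValiantsHypothesis.Theorems.MonotoneRestorationMonotoneRestorationQPCosetCount
import Summits.ValiantsHypothesis.ValiantsHypothesis.Theorems.MonotoneRestorationMonotoneRestorationQPSymmetricLB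
import Summits.ValiantsHypothesis.ValiantsHypothesis.Theorems.MonotoneRestorationMonotoneRestorationQPSupportSymmetrisation
import Summits.ValiantsHypothesis.ValiantsHypothesis.Theorems.MonotoneRestorationMonotoneRestorationQPSparseRegime
import Summits.ValiantsHypothesis.ValiantsHypothesis.Theorems.MonotoneRestorationMonotoneRestorationQPBeta
import Literature.Computability.AlgebraicComplexity.SymmetricArithCircuit
import Literature.Computability.AlgebraicComplexity.DawarWilsenach2025Proofs
import Literature.GroupTheory.PermutationGroups.SmallIndexSubgroups
import Summits.ValiantsHypothesis.ValiantsHypothesis.Theorems.MonotoneRestorationQP.Negative.LoadBearing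
import Summits.ValiantsHypothesis.ValiantsHypothesis.Theorems.MonotoneRestorationMonotoneRestorationQPPermSupportCount
import Summits.ValiantsHypothesis.ValiantsHypothesis.Theorems.MonotoneRestorationMonotoneRestorationQPVariants19019

/-! TTRL-lite variant V18973 of stmt-ValiantsHypothesis-15886 -/

-- `Summit.ValiantsHypothesis.ValiantsHypothesis.…` is the tree's mandated single-conjunct layout
-- (Sub = Summit), so the duplicated namespace component is intended.
set_option linter.dupNamespace false

namespace Summit.ValiantsHypothesis.ValiantsHypothesis.Theorems

open Summit.ValiantsHypothesis.ValiantsHypothesis.Theses.MonotoneRestoration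
open Literature.Computability.AlgebraicComplexity

/-- TTRL-lite variant V18973: `trimJunk` (replace junk references by `const 0`) keeps a plain
circuit plain (the coefficients of sum gates are kept by `Gate.truncate`), keeps fan-in two, is
well formed, computes the same polynomial and has the same size. -/
theorem stub_monotoneComputation_of_complexity_var18973 :
    ∀ (σ : Type) (P : ArithCircuit NNReal σ),
      Literature.Barriers.ValiantsHypothesis.IsPlain P →
        Literature.Barriers.ValiantsHypothesis.IsPlain P.trimJunk ∧
          (P.IsFanInTwo → P.trimJunk.IsFanInTwo) ∧ P.trimJunk.WellFormed ∧
            P.trimJunk.eval = P.eval ∧ P.trimJunk.size = P.size := by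
  intro σ P hplain
  exact ⟨isPlain_trimJunk_var19019 hplain, fun hfan => hfan.trimJunk,
    ArithCircuit.wellFormed_trimJunk P, ArithCircuit.eval_trimJunk P,
    ArithCircuit.size_trimJunk P⟩

end Summit.ValiantsHypothesis.ValiantsHypothesis.Theorems
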